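import Mathlib
import Summits.ValiantsHypothesis.ValiantsHypothesis.Theses.ProofCarryingSymmetry
import Summits.ValiantsHypothesis.ValiantsHypothesis.Theorems.ProofCarryingSymmetryRestorationQPDistEq

/-!
# Route ProofCarryingSymmetry — crux `RestorationQP`, line `registered`: soundness at distributivity budget ONE

Support file for the crux item `stmt-ValiantsHypothesis-10343` (lead c4, cycle 4).  The bet S2⁗ is a
theorem at distributivity budget `t = 0` (`proofCarryingSymmetry_at_distBudgetZero`); its first open
graded instance S3^(1) allows ONE instance of A6 per invariance proof.  This file turns that
proof-theoretic hypothesis into the combinatorial one the coset-covering mechanism consumes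
(CYCLE4-REPORT.md): a `P_f(𝔽)` proof whose lines contain at most one instance of distributivity
relates formulas that are congruent modulo A1–A5, A7–A10 AND ONE GROUND EQUATION
`P·(Q+R) = P·Q + P·R` — the one A6 line, usable any number of times through the rules R1–R4.

* `UCEqWith e` — the congruence generated by `UCEq` (the distributivity-free fragment, part 1 of
  rung S3⁗) and the single ground equation `e`; sound (`UCEqWith.eval_eq`).
* `IsDistInstance e` — `e` is a ground instance of A6.
* `ucEqWith_of_pfProof`, `ucEqWith_of_pfProvable` — SOUNDNESS AT BUDGET ONE: a `P_f` proof with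
  `axiomCount A6 ≤ 1` has all its lines in `UCEqWith e` for one `e` that is a distributivity
  instance or trivial.
* `stabilityAtDistOne_of_core` — hence S3^(1) (stability when every invariance proof of the
  unfoldings uses at most one distributivity instance) FOLLOWS from its combinatorial core
  CORE(1): "if for every `σ` some ground distributivity instance `e_σ` has
  `UCEqWith e_σ (C∘σ)• C•`, then an `S_n`-symmetric circuit of size `≤ (|C|+n+2)^c` computes `Ĉ`"
  — the statement the Church–Rosser ∘ Neumann (`exists_index_le_of_saturation_cover`) ∘ coset
  induction (`exists_isSymmetric_induced`) pipeline is to prove.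

Everything here is elementary and proved; CORE(1) itself is NOT claimed.
-/

-- single-problem summit: `Summit.ValiantsHypothesis.ValiantsHypothesis.…` is the namespace by design (D-0017)
set_option linter.dupNamespace false

namespace Summit.ValiantsHypothesis.ValiantsHypothesis.Theorems

namespace ACStability

open Literature.Computability.AlgebraicComplexity

universe u v w

variable {𝔽 : Type u} [CommSemiring 𝔽] {X : Type v} {Y : Type w}

/-! ### The congruence with one ground equation -/

/-- `UCEqWith e F G`: `F = G` is derivable from A1–A5, A7–A10, the rules R1–R4 and the single
ground equation `e.1 = e.2`. [folklore] -/
inductive UCEqWith (e : PIFormula 𝔽 X × PIFormula 𝔽 X) : PIFormula 𝔽 X → PIFormula 𝔽 X → Prop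
  /-- the distributivity-free fragment -/
  | base {F G : PIFormula 𝔽 X} : UCEq F G → UCEqWith e F G
  /-- the ground equation -/
  | inst : UCEqWith e e.1 e.2
  /-- R1 -/
  | symm {F G : PIFormula 𝔽 X} : UCEqWith e F G → UCEqWith e G F
  /-- R2 -/
  | trans {F G H : PIFormula 𝔽 X} : UCEqWith e F G → UCEqWith e G H → UCEqWith e F H
  /-- R3 -/
  | add_congr {F F' G G' : PIFormula 𝔽 X} :
      UCEqWith e F F' → UCEqWith e G G' → UCEqWith e (.add F G) (.add F' G')
  /-- R4 -/
  | mul_congr {F F' G G' : PIFormula 𝔽 X} :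
      UCEqWith e F F' → UCEqWith e G G' → UCEqWith e (.mul F G) (.mul F' G')

/-- `UCEqWith` is reflexive. [folklore] -/
theorem UCEqWith.refl (e : PIFormula 𝔽 X × PIFormula 𝔽 X) (F : PIFormula 𝔽 X) : UCEqWith e F F :=
  .base (.refl F)

/-- Soundness: if the ground equation is true, `UCEqWith`-related formulas compute the same
polynomial. [folklore] -/
theorem UCEqWith.eval_eq {e : PIFormula 𝔽 X × PIFormula 𝔽 X} (he : e.1.eval = e.2.eval)
    {F G : PIFormula 𝔽 X} (h : UCEqWith e F G) : F.eval = G.eval := by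
  induction h with
  | base h => exact h.eval_eq
  | inst => exact he
  | symm _ ih => exact ih.symm
  | trans _ _ ih₁ ih₂ => exact ih₁.trans ih₂
  | add_congr _ _ ih₁ ih₂ => simp only [PIFormula.eval, ih₁, ih₂]
  | mul_congr _ _ ih₁ ih₂ => simp only [PIFormula.eval, ih₁, ih₂]

/-- A trivial ground equation adds nothing. [folklore] -/
theorem UCEqWith.ucEq_of_fst_eq_snd {e : PIFormula 𝔽 X × PIFormula 𝔽 X} (he : e.1 = e.2)
    {F G : PIFormula 𝔽 X} (h : UCEqWith e F G) : UCEq F G := by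
  induction h with
  | base h => exact h
  | inst => rw [he]; exact .refl _
  | symm _ ih => exact ih.symm
  | trans _ _ ih₁ ih₂ => exact ih₁.trans ih₂
  | add_congr _ _ ih₁ ih₂ => exact .add_congr ih₁ ih₂
  | mul_congr _ _ ih₁ ih₂ => exact .mul_congr ih₁ ih₂

/-- Monotonicity in the ground equation: an equation derivable from `e'` may replace `e'`.
[folklore] -/
theorem UCEqWith.mono {e e' : PIFormula 𝔽 X × PIFormula 𝔽 X} (hee : UCEqWith e e'.1 e'.2)
    {F G : PIFormula 𝔽 X} (h : UCEqWith e' F G) : UCEqWith e F G := by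
  induction h with
  | base h => exact .base h
  | inst => exact hee
  | symm _ ih => exact ih.symm
  | trans _ _ ih₁ ih₂ => exact ih₁.trans ih₂
  | add_congr _ _ ih₁ ih₂ => exact .add_congr ih₁ ih₂
  | mul_congr _ _ ih₁ ih₂ => exact .mul_congr ih₁ ih₂

/-- `e` is a GROUND INSTANCE OF DISTRIBUTIVITY: `e = (P·(Q+R), P·Q + P·R)`. [folklore] -/
def IsDistInstance (e : PIFormula 𝔽 X × PIFormula 𝔽 X) : Prop :=
  ∃ P Q R : PIFormula 𝔽 X, e = (.mul P (.add Q R), .add (.mul P Q) (.mul P R))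

/-- A distributivity instance is a true equation. [folklore] -/
theorem IsDistInstance.eval_eq {e : PIFormula 𝔽 X × PIFormula 𝔽 X} (h : IsDistInstance e) :
    e.1.eval = e.2.eval := by
  obtain ⟨P, Q, R, rfl⟩ := h
  simp only [PIFormula.eval]
  ring

/-- An A6 axiom instance of `P_f` is a ground distributivity instance. [folklore] -/
theorem isDistInstance_of_ringAxiom_a6 {F G : PIFormula 𝔽 X}
    (h : (pfSystem 𝔽 X).RingAxiom PIAxiom.A6 F G) : IsDistInstance (F, G) := by
  cases h with
  | a6 P Q R => exact ⟨P, Q, R, rfl⟩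

/-! ### Soundness at budget one -/

/-- In a `P_f` proof with NO instance of A6 every line is in the distributivity-free fragment
(restated from part 1 of rung S3⁗ with the count hypothesis in the form used below). [folklore] -/
theorem ucEq_of_pfProof_count_zero {Γ : List (PIFormula 𝔽 X × PIFormula 𝔽 X)} (π : PFProof 𝔽 X Γ)
    (h : π.axiomCount PIAxiom.A6 = 0) : ∀ {F G : PIFormula 𝔽 X}, (F, G) ∈ Γ → UCEq F G :=
  ucEq_of_pfProof π fun s hs => by rw [show s = PIAxiom.A6 from hs]; exact h

/-- **Soundness at distributivity budget one.** In a `P_f` proof with at most one instance of A6,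
all lines are congruent modulo A1–A5, A7–A10 and ONE ground equation `e`, which is a
distributivity instance (the A6 line) or trivial (if there is none). [folklore] -/
theorem ucEqWith_of_pfProof {Γ : List (PIFormula 𝔽 X × PIFormula 𝔽 X)} (π : PFProof 𝔽 X Γ)
    (h : π.axiomCount PIAxiom.A6 ≤ 1) :
    ∃ e : PIFormula 𝔽 X × PIFormula 𝔽 X, (IsDistInstance e ∨ e.1 = e.2) ∧
      ∀ {F G : PIFormula 𝔽 X}, (F, G) ∈ Γ → UCEqWith e F G := by
  induction π with
  | nil => exact ⟨(.const 0, .const 0), Or.inr rfl, fun hm => by simp at hm⟩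
  | axm s' hax π ih =>
    rename_i Γ' F' G'
    by_cases hs : s' = PIAxiom.A6
    · subst hs
      -- the A6 line is the ground equation; the rest of the proof is distributivity-free
      have h0 : π.axiomCount PIAxiom.A6 = 0 := by
        simp only [PIProof.axiomCount, if_true] at h; omega
      refine ⟨(F', G'), ?_, fun hm => ?_⟩
      · rcases hax with hax | hax
        · exact Or.inl (isDistInstance_of_ringAxiom_a6 hax)
        · exact hax.elim
      · rcases List.mem_cons.1 hm with hm | hm
        · obtain ⟨rfl, rfl⟩ := Prod.mk.injEq _ _ _ _ ▸ hm
          exact .inst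
        · exact .base (ucEq_of_pfProof_count_zero π h0 hm)
    · have hπ : π.axiomCount PIAxiom.A6 ≤ 1 := by
        simp only [PIProof.axiomCount, if_neg hs] at h; omega
      obtain ⟨e, he, hall⟩ := ih hπ
      refine ⟨e, he, fun hm => ?_⟩
      rcases List.mem_cons.1 hm with hm | hm
      · obtain ⟨rfl, rfl⟩ := Prod.mk.injEq _ _ _ _ ▸ hm
        rcases hax with hax | hax
        · exact .base (ucEq_of_ringAxiom_pf hs hax)
        · exact hax.elim
      · exact hall hm
  | symm hm' π ih =>
    obtain ⟨e, he, hall⟩ := ih h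
    refine ⟨e, he, fun hm => ?_⟩
    rcases List.mem_cons.1 hm with hm | hm
    · obtain ⟨rfl, rfl⟩ := Prod.mk.injEq _ _ _ _ ▸ hm
      exact (hall hm').symm
    · exact hall hm
  | trans h₁ h₂ π ih =>
    obtain ⟨e, he, hall⟩ := ih h
    refine ⟨e, he, fun hm => ?_⟩
    rcases List.mem_cons.1 hm with hm | hm
    · obtain ⟨rfl, rfl⟩ := Prod.mk.injEq _ _ _ _ ▸ hm
      exact (hall h₁).trans (hall h₂)
    · exact hall hm
  | addRule h₁ h₂ hF hG π ih =>
    obtain ⟨e, he, hall⟩ := ih h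
    refine ⟨e, he, fun hm => ?_⟩
    rcases List.mem_cons.1 hm with hm | hm
    · obtain ⟨rfl, rfl⟩ := Prod.mk.injEq _ _ _ _ ▸ hm
      subst hF hG
      exact .add_congr (hall h₁) (hall h₂)
    · exact hall hm
  | mulRule h₁ h₂ hF hG π ih =>
    obtain ⟨e, he, hall⟩ := ih h
    refine ⟨e, he, fun hm => ?_⟩
    rcases List.mem_cons.1 hm with hm | hm
    · obtain ⟨rfl, rfl⟩ := Prod.mk.injEq _ _ _ _ ▸ hm
      subst hF hG
      exact .mul_congr (hall h₁) (hall h₂)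
    · exact hall hm

/-- **Budget-one provability, combinatorially.** If `F = G` is provable in `P_f(𝔽)` within a
budget allowing at most one instance of A6, then `UCEqWith e F G` for a ground distributivity
instance `e` (a trivial ground equation being absorbed: then already `UCEq F G`, and any
distributivity instance will do). [folklore] -/
theorem ucEqWith_of_pfProvable {F G : PIFormula 𝔽 X} {b : PIAxiom → ℕ∞}
    (hb : b PIAxiom.A6 ≤ 1) (h : (pfSystem 𝔽 X).Provable F G ⊤ b) :
    ∃ e : PIFormula 𝔽 X × PIFormula 𝔽 X, IsDistInstance e ∧ UCEqWith e F G := by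
  obtain ⟨Γ, π, -, hπ⟩ := h
  have h1 : π.axiomCount PIAxiom.A6 ≤ 1 := by
    have := (hπ PIAxiom.A6).trans hb
    exact_mod_cast this
  obtain ⟨e, he, hall⟩ := ucEqWith_of_pfProof π h1
  rcases he with he | he
  · exact ⟨e, he, hall List.mem_cons_self⟩
  · -- trivial ground equation: `UCEq F G`; pad with the instance `0·(0+0) = 0·0 + 0·0`
    refine ⟨(.mul (.const 0) (.add (.const 0) (.const 0)),
        .add (.mul (.const 0) (.const 0)) (.mul (.const 0) (.const 0))), ⟨_, _, _, rfl⟩, ?_⟩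
    exact .base ((hall List.mem_cons_self).ucEq_of_fst_eq_snd he)

end ACStability

open Literature.Computability.AlgebraicComplexity

/-- **S3^(1) follows from its combinatorial core CORE(1).**  If, for every circuit whose renamed
unfoldings are, for each `σ ∈ S_n`, congruent to its unfolding modulo A1–A5, A7–A10 and ONE ground
distributivity instance `e_σ`, some `S_n`-symmetric labelled circuit of size `≤ (|C|+n+2)^c`
computes `Ĉ` (CORE(1) — the statement the coset-covering pipeline is to prove; NOT claimed here),
then stability holds at distributivity budget one: `P_f(ℂ)` inter-derivability of `(C∘σ)•` and
`C•` with at most one A6 instance for every `σ` yields such a symmetric circuit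
(`ACStability.ucEqWith_of_pfProvable`). [folklore] -/
theorem stabilityAtDistOne_of_core : ∀ c : ℕ, (∀ (n : ℕ) (C : PICircuit ℂ (Fin n × Fin n)), (∀ σ : Equiv.Perm (Fin n), ∃ e : PIFormula ℂ (Fin n × Fin n) × PIFormula ℂ (Fin n × Fin n), ACStability.IsDistInstance e ∧ ACStability.UCEqWith e (C.rename fun x : Fin n × Fin n => σ • x).unfold C.unfold) → ∃ (G : Type) (_ : Fintype G) (D : LabelledArithCircuit ℂ (Fin n × Fin n) Unit G), D.IsSymmetric (Equiv.Perm (Fin n)) ∧ D.eval (D.output ()) = C.eval ∧ Fintype.card G ≤ (C.size + n + 2) ^ c) → ∀ (n : ℕ) (C : PICircuit ℂ (Fin n × Fin n)), (∀ σ : Equiv.Perm (Fin n), (pfSystem ℂ (Fin n × Fin n)).Provable (C.rename fun x : Fin n × Fin n => σ • x).unfold C.unfold ⊤ (fun s => if s = PIAxiom.A6 then 1 else ⊤)) → ∃ (G : Type) (_ : Fintype G) (D : LabelledArithCircuit ℂ (Fin n × Fin n) Unit G), D.IsSymmetric (Equiv.Perm (Fin n)) ∧ D.eval (D.output ()) =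 C.eval ∧ Fintype.card G ≤ (C.size + n + 2) ^ c :=
  fun _ core n C h => core n C fun σ =>
    ACStability.ucEqWith_of_pfProvable (b := fun s => if s = PIAxiom.A6 then 1 else ⊤)
      (by simp) (h σ)

end Summit.ValiantsHypothesis.ValiantsHypothesis.Theorems
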